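import Summits.ValiantsHypothesis.ValiantsHypothesis.Theorems.KPlusLogSqLawWeakLiftingTowerGraftTwoSidedThreeLettersGapFour
import Summits.ValiantsHypothesis.ValiantsHypothesis.Theorems.KPlusLogSqLawWeakLiftingTowerGraftTwoSidedThreeLettersDefinite

/-!
# The `(d, d+e, d+5e)` `2m` law for DEFINITE-TYPE roots of any corank (pub-symmetroid LINE (B) `tower_graft`, helper lane)

Part E (`TwoSidedThree.card_posRoots_le_two_mul_gap_four`) proves `Z₊ ≤ 2m` for `X^{d}A + X^{d+e}J + X^{d+5e}B` (`A ≻ 0`, `B ≻ 0`,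
`J` any symmetric) under SIMPLE CROSSINGS.  As part D did for the gap-2 word and part I for four letters, the corank restriction is
removed: part C's abstract certificate theorem is re-proved for families with REPEATED scales
(`card_posType_le_rank_of_certificate_family`, same-scale Gram identity as hypothesis `hsame`), instantiated at gap 4 with the
certificate `N = [1/(sᵢsₖ(sᵢ+sₖ)(sᵢ²+sₖ²))]` (`card_posType_family_le_rank_gap_four`; for a same-scale pair the identity is
orthogonality for `4s⁵B − A`), and assembled with `exists_kernel_orthogonal_family` and the inertia kit into
`card_posRoots_le_two_mul_gap_four_of_definite`.

Honest scope: the three-letter word at gap 4; nothing on S4/S4b/S4d/S4f/S5, (TB), 19561 proper, 18050, VP ≠ VNP.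
-/

set_option linter.dupNamespace false
set_option autoImplicit false

namespace Summit.ValiantsHypothesis.ValiantsHypothesis.Theorems.KPlusLogSqLaw.TowerGraft

open Matrix
open scoped BigOperators

namespace TwoSidedThree

section GapFourFamily

variable {m : ℕ} {I : Type} [Fintype I] [DecidableEq I]

variable (A J B : Matrix (Fin m) (Fin m) ℝ) (n : ℕ) (s : I → ℝ) (u : I → Fin m → ℝ)

/-- **Abstract certificate theorem for families with repeated scales** (cf. `card_posType_le_rank_of_certificate`): the
off-diagonal certificate relation is only required for `sᵢ ≠ sₖ`; for a same-scale pair `i ≠ k` the Gram identity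
`⟨uᵢ,Buₖ⟩ = N[i,k]·⟨uᵢ,Auₖ⟩` is a hypothesis (`hsame`).  Conclusion: positive-type kernel pairs number at most `rank B`. [folklore] -/
theorem card_posType_le_rank_of_certificate_family (hA : A.PosSemidef) (hJ : J.IsSymm) (hB : B.PosSemidef)
    (hs : ∀ i, 0 < s i)
    (hker : ∀ i, (A + s i • J + s i ^ (n + 1) • B) *ᵥ u i = 0)
    (htype : ∀ i, u i ⬝ᵥ (A *ᵥ u i) < n * s i ^ (n + 1) * (u i ⬝ᵥ (B *ᵥ u i)))
    (N : Matrix I I ℝ) (hN : N.PosSemidef) (hNdiag : ∀ i, N i i * (n * s i ^ (n + 1)) = 1)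
    (hNoff : ∀ i k, s i ≠ s k → N i k * (s i * s k * (s i ^ n - s k ^ n)) = s i - s k)
    (hsame : ∀ i k, i ≠ k → s i = s k → u i ⬝ᵥ (B *ᵥ u k) = (u i ⬝ᵥ (A *ᵥ u k)) * N i k) :
    Fintype.card I ≤ B.rank := by
  classical
  have hAs : A.IsSymm := by
    have h1 := hA.1; unfold Matrix.IsHermitian at h1
    rwa [Matrix.conjTranspose_eq_transpose_of_trivial] at h1
  have hBs : B.IsSymm := by
    have h1 := hB.1; unfold Matrix.IsHermitian at h1
    rwa [Matrix.conjTranspose_eq_transpose_of_trivial] at h1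
  have hGA : (Matrix.of fun i' k' => u i' ⬝ᵥ (A *ᵥ u k')).PosSemidef := posSemidef_gram hA u
  have hH : ((Matrix.of fun i' k' => u i' ⬝ᵥ (A *ᵥ u k')) ⊙ N).PosSemidef := hGA.hadamard hN
  set Δ : I → ℝ := fun i => u i ⬝ᵥ (B *ᵥ u i) - (u i ⬝ᵥ (A *ᵥ u i)) * N i i with hΔdef
  have hΔpos : ∀ i, 0 < Δ i := by
    intro i
    have ht := htype i
    have hn : (0 : ℝ) < n := by
      rcases Nat.eq_zero_or_pos n with h0 | h0
      · exfalso
        subst h0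
        have ha : 0 ≤ u i ⬝ᵥ (A *ᵥ u i) := by
          have h := (Matrix.posSemidef_iff_dotProduct_mulVec.mp hA).2 (u i)
          rwa [star_trivial] at h
        simp only [Nat.cast_zero, zero_mul] at ht
        linarith
      · exact_mod_cast h0
    have hsi : 0 < (n : ℝ) * s i ^ (n + 1) := by have := hs i; positivity
    have hNii : N i i = 1 / (n * s i ^ (n + 1)) := by
      rw [eq_div_iff (ne_of_gt hsi)]
      exact hNdiag i
    show 0 < u i ⬝ᵥ (B *ᵥ u i) - (u i ⬝ᵥ (A *ᵥ u i)) * N i i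
    rw [hNii, sub_pos, mul_one_div, div_lt_iff₀ hsi]
    linarith
  have hdecomp : (Matrix.of fun i' k' => u i' ⬝ᵥ (B *ᵥ u k'))
      = (Matrix.of fun i' k' => u i' ⬝ᵥ (A *ᵥ u k')) ⊙ N + Matrix.diagonal Δ := by
    ext i k
    rw [Matrix.add_apply, Matrix.hadamard_apply, Matrix.of_apply, Matrix.of_apply]
    by_cases hik : i = k
    · subst hik
      rw [Matrix.diagonal_apply_eq]
      simp only [hΔdef]; ring
    · rw [Matrix.diagonal_apply_ne _ hik, add_zero]
      by_cases hsik : s i = s k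
      · exact hsame i k hik hsik
      · have h1 := gramA_eq_gen A J B n s u hAs hJ hBs hker i k
        have h2 := hNoff i k hsik
        have hne : s i - s k ≠ 0 := sub_ne_zero.mpr hsik
        have hne' : s i * s k * (s i ^ n - s k ^ n) ≠ 0 := by
          intro h0; rw [h0, mul_zero] at h2; exact hne h2.symm
        have h3 : (u i ⬝ᵥ (B *ᵥ u k)) * (s i * s k * (s i ^ n - s k ^ n))
            = (u i ⬝ᵥ (A *ᵥ u k)) * N i k * (s i * s k * (s i ^ n - s k ^ n)) := by
          rw [mul_assoc (u i ⬝ᵥ (A *ᵥ u k)), h2]; linarith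
        exact mul_right_cancel₀ hne' h3
  have hGB : (Matrix.of fun i' k' => u i' ⬝ᵥ (B *ᵥ u k')).PosDef := by
    rw [Matrix.posDef_iff_dotProduct_mulVec]
    refine ⟨(posSemidef_gram hB u).1, fun x hx => ?_⟩
    rw [hdecomp, Matrix.add_mulVec, dotProduct_add]
    have h1 : 0 ≤ star x ⬝ᵥ (((Matrix.of fun i' k' => u i' ⬝ᵥ (A *ᵥ u k')) ⊙ N) *ᵥ x) :=
      (Matrix.posSemidef_iff_dotProduct_mulVec.mp hH).2 x
    have h2 : 0 < star x ⬝ᵥ (Matrix.diagonal Δ *ᵥ x) := by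
      rw [star_trivial]
      simp only [dotProduct, Matrix.mulVec_diagonal]
      obtain ⟨i₀, hi₀⟩ := Function.ne_iff.mp hx
      apply Finset.sum_pos'
      · intro i _
        have := hΔpos i
        nlinarith [sq_nonneg (x i)]
      · refine ⟨i₀, Finset.mem_univ _, ?_⟩
        have := hΔpos i₀
        have hx0 : 0 < x i₀ ^ 2 := sq_pos_iff.mpr hi₀
        nlinarith
    linarith
  have hrank : (Matrix.of fun i' k' => u i' ⬝ᵥ (B *ᵥ u k')).rank = Fintype.card I := Matrix.rank_of_isUnit _ hGB.isUnit
  rw [← hrank]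
  exact rank_gram_le B u

/-- **gap-`4` family instance** (`A + sJ + s⁵B`; scales may repeat): certificate `N = [1/(sᵢsₖ(sᵢ+sₖ)(sᵢ²+sₖ²))]` as in
`card_posType_le_rank_gap_four`; a same-scale pair needs `4s⁵⟨uᵢ,Buₖ⟩ = ⟨uᵢ,Auₖ⟩` (`hsame`). [folklore] -/
theorem card_posType_family_le_rank_gap_four (hA : A.PosSemidef) (hJ : J.IsSymm) (hB : B.PosSemidef)
    (hs : ∀ i, 0 < s i)
    (hker : ∀ i, (A + s i • J + s i ^ 5 • B) *ᵥ u i = 0)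
    (htype : ∀ i, u i ⬝ᵥ (A *ᵥ u i) < 4 * s i ^ 5 * (u i ⬝ᵥ (B *ᵥ u i)))
    (hsame : ∀ i k, i ≠ k → s i = s k → 4 * s i ^ 5 * (u i ⬝ᵥ (B *ᵥ u k)) = u i ⬝ᵥ (A *ᵥ u k)) :
    Fintype.card I ≤ B.rank := by
  classical
  set N : Matrix I I ℝ := Matrix.of fun i k => (s i)⁻¹ * (1 / (s i + s k) * (1 / (s i ^ 2 + s k ^ 2))) * (s k)⁻¹ with hNdef
  refine card_posType_le_rank_of_certificate_family A J B 4 s u hA hJ hB hs (by simpa using hker)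
    (fun i => by have := htype i; push_cast; linarith) N ?_ ?_ ?_ ?_
  · have hC1 := posSemidef_cauchy s hs
    have hC2 := posSemidef_cauchy (fun i => s i ^ 2) (fun i => pow_pos (hs i) 2)
    have hH := hC1.hadamard hC2
    have hNeq : N = (Matrix.diagonal fun i => (s i)⁻¹)
        * ((Matrix.of fun i k : I => 1 / (s i + s k)) ⊙ (Matrix.of fun i k : I => 1 / (s i ^ 2 + s k ^ 2)))
        * (Matrix.diagonal fun i => (s i)⁻¹) := by
      ext i k
      simp only [hNdef, Matrix.of_apply, Matrix.mul_diagonal, Matrix.diagonal_mul, Matrix.hadamard_apply]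
    rw [hNeq]
    have h := hH.conjTranspose_mul_mul_same (Matrix.diagonal fun i => (s i)⁻¹)
    rwa [Matrix.conjTranspose_eq_transpose_of_trivial, Matrix.diagonal_transpose] at h
  · intro i
    simp only [hNdef, Matrix.of_apply]
    have := ne_of_gt (hs i)
    field_simp
    ring
  · intro i k _
    simp only [hNdef, Matrix.of_apply]
    have := ne_of_gt (hs i); have := ne_of_gt (hs k); have := ne_of_gt (add_pos (hs i) (hs k))
    have := ne_of_gt (add_pos (pow_pos (hs i) 2) (pow_pos (hs k) 2))
    field_simp
    ring
  · intro i k hik hsik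
    simp only [hNdef, Matrix.of_apply]
    have h := hsame i k hik hsik
    rw [← hsik]
    have := ne_of_gt (hs i)
    have h2 : s i ^ 2 + s i ^ 2 = 2 * s i ^ 2 := by ring
    have h3 : s i + s i = 2 * s i := by ring
    rw [h2, h3]
    field_simp
    linear_combination h

end GapFourFamily

/-! ## The census-currency law for definite-type roots of any corank, gap 4 -/

section GapFourDefinite

open Polynomial
open Summit.ValiantsHypothesis.ValiantsHypothesis.Theorems.LacunarySymmetroidMatrixDescartes

variable {m : ℕ}

/-- **THE `(d, d+e, d+5e)` `2m` LAW, DEFINITE TYPE (any corank).**  `A ≻ 0`, `B ≻ 0`, `J` ANY symmetric, `e ≥ 1`,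
`F(X) = X^{d}A + X^{d+e}J + X^{d+5e}B`; if every positive root of `det F` is of DEFINITE type then `det F` has at most `2m` positive
roots counted with multiplicity (part E's `hcorank` removed).  Route: orthogonal kernel bases for `B − A/(4s⁵)` at each positive-type root,
`card_posType_family_le_rank_gap_four`, `Inertia.sum_corank_eq_card_roots_filter`, `Inertia.global_index_formula`. [folklore] -/
theorem card_posRoots_le_two_mul_gap_four_of_definite (A J B : Matrix (Fin m) (Fin m) ℝ) (hA : A.PosDef) (hJ : J.IsSymm) (hB : B.PosDef)
    (d₀ e : ℕ) (he : 0 < e)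
    (htype : ∀ t : ℝ, 0 < t → (∑ k : Fin 3, t ^ (![d₀, d₀ + e, d₀ + 5 * e] k) • (![A, J, B] k)).det = 0 →
      (∀ u : Fin m → ℝ, (∑ k : Fin 3, t ^ (![d₀, d₀ + e, d₀ + 5 * e] k) • (![A, J, B] k)) *ᵥ u = 0 → u ≠ 0 →
        (derivative (∑ k : Fin 3, C (u ⬝ᵥ ((![A, J, B] k) *ᵥ u)) * (X : ℝ[X]) ^ (![d₀, d₀ + e, d₀ + 5 * e] k))).eval t < 0) ∨
      (∀ u : Fin m → ℝ, (∑ k : Fin 3, t ^ (![d₀, d₀ + e, d₀ + 5 * e] k) • (![A, J, B] k)) *ᵥ u = 0 → u ≠ 0 →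
        0 < (derivative (∑ k : Fin 3, C (u ⬝ᵥ ((![A, J, B] k) *ᵥ u)) * (X : ℝ[X]) ^ (![d₀, d₀ + e, d₀ + 5 * e] k))).eval t)) :
    Multiset.card ((Matrix.det (∑ k : Fin 3, ((X : ℝ[X]) ^ (![d₀, d₀ + e, d₀ + 5 * e] k)) • (![A, J, B] k).map C)).roots.filter
        (fun t => 0 < t)) ≤ 2 * m := by
  classical
  set dv : Fin 3 → ℕ := ![d₀, d₀ + e, d₀ + 5 * e] with hdv
  set Sv : Fin 3 → Matrix (Fin m) (Fin m) ℝ := ![A, J, B] with hSv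
  have hAs : A.IsSymm := by
    have h1 := hA.1; unfold Matrix.IsHermitian at h1
    rwa [Matrix.conjTranspose_eq_transpose_of_trivial] at h1
  have hBs : B.IsSymm := by
    have h1 := hB.1; unfold Matrix.IsHermitian at h1
    rwa [Matrix.conjTranspose_eq_transpose_of_trivial] at h1
  have hS : ∀ k, (Sv k).IsSymm := by
    intro k; fin_cases k
    · exact hAs
    · exact hJ
    · exact hBs
  have hmin : ∀ l : Fin 3, l ≠ 0 → dv 0 < dv l := by
    intro l hl; fin_cases l
    · exact absurd rfl hl
    · show d₀ < d₀ + e; omega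
    · show d₀ < d₀ + 5 * e; omega
  have hmax : ∀ l : Fin 3, l ≠ 2 → dv l < dv 2 := by
    intro l hl; fin_cases l
    · show d₀ < d₀ + 5 * e; omega
    · show d₀ + e < d₀ + 5 * e; omega
    · exact absurd rfl hl
  have h0 : (Sv 0).det ≠ 0 := by show A.det ≠ 0; exact hA.det_pos.ne'
  have h2 : (Sv 2).det ≠ 0 := by show B.det ≠ 0; exact hB.det_pos.ne'
  let negType : ℝ → Prop := fun t => ∀ u : Fin m → ℝ, (∑ k, t ^ dv k • Sv k) *ᵥ u = 0 → u ≠ 0 →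
    (derivative (∑ k, C (u ⬝ᵥ (Sv k *ᵥ u)) * (X : ℝ[X]) ^ dv k)).eval t < 0
  obtain ⟨hidx, -, hsum⟩ := Inertia.global_index_formula dv Sv hS 0 2 hmin hmax h0 h2 htype negType
    (fun t _ _ => Iff.rfl)
  have hνA : Fintype.card {j // (Inertia.isHermitian_of_isSymm (hS 0)).eigenvalues j < 0} = 0 := by
    rw [Fintype.card_eq_zero_iff]
    refine ⟨fun ⟨j, hj⟩ => ?_⟩
    have hp : 0 < (Inertia.isHermitian_of_isSymm (hS 0)).eigenvalues j := hA.eigenvalues_pos j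
    linarith
  have hνB : Fintype.card {j // (Inertia.isHermitian_of_isSymm (hS 2)).eigenvalues j < 0} = 0 := by
    rw [Fintype.card_eq_zero_iff]
    refine ⟨fun ⟨j, hj⟩ => ?_⟩
    have hp : 0 < (Inertia.isHermitian_of_isSymm (hS 2)).eigenvalues j := hB.eigenvalues_pos j
    linarith
  rw [hνA, hνB, zero_add, zero_add] at hidx
  set P := Matrix.det (∑ k, ((X : ℝ[X]) ^ dv k) • (Sv k).map C) with hP
  set q : ℝ → Prop := fun t => 0 < t ∧ ¬ negType t with hq
  -- `N⁺ = ∑ corank` over the distinct positive-type roots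
  have hdef : ∀ t ∈ P.roots.toFinset.filter q, ∀ v : Fin m → ℝ, (∑ k, t ^ dv k • Sv k) *ᵥ v = 0 → v ≠ 0 →
      (derivative (∑ k, C (v ⬝ᵥ (Sv k *ᵥ v)) * (X : ℝ[X]) ^ dv k)).eval t ≠ 0 := by
    intro t ht v hv hv0
    obtain ⟨hmem, htq⟩ := Finset.mem_filter.mp ht
    obtain ⟨-, hroot⟩ := (Polynomial.mem_roots').mp (Multiset.mem_toFinset.mp hmem)
    have hdet : (∑ k, t ^ dv k • Sv k).det = 0 := by
      have h1 : P.eval t = 0 := hroot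
      rwa [hP, DefiniteMoments.eval_det_pencil] at h1
    rcases htype t htq.1 hdet with h | h
    · exact ne_of_lt (h v hv hv0)
    · exact ne_of_gt (h v hv hv0)
  have hN : ∑ t ∈ P.roots.toFinset.filter q, (Fintype.card (Fin m) - (∑ k, t ^ dv k • Sv k).rank)
      = Multiset.card (P.roots.filter q) := Inertia.sum_corank_eq_card_roots_filter dv Sv hS q hdef
  -- positive type at every root of `T`
  set T := P.roots.toFinset.filter q with hTdef
  have hTpos : ∀ t ∈ T, 0 < t := fun t ht => (Finset.mem_filter.mp ht).2.1
  have hTtype : ∀ t ∈ T, ∀ u : Fin m → ℝ, (∑ k, t ^ dv k • Sv k) *ᵥ u = 0 → u ≠ 0 →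
      0 < (derivative (∑ k, C (u ⬝ᵥ (Sv k *ᵥ u)) * (X : ℝ[X]) ^ dv k)).eval t := by
    intro t ht u hu hu0
    obtain ⟨hmem, htq⟩ := Finset.mem_filter.mp ht
    obtain ⟨-, hroot⟩ := (Polynomial.mem_roots').mp (Multiset.mem_toFinset.mp hmem)
    have hdet : (∑ k, t ^ dv k • Sv k).det = 0 := by
      have h1 : P.eval t = 0 := hroot
      rwa [hP, DefiniteMoments.eval_det_pencil] at h1
    rcases htype t htq.1 hdet with hneg | hposT
    · exact absurd hneg htq.2
    · exact hposT u hu hu0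
  -- an orthogonal kernel family at each root of `T`, for the form `Φ_t = B − A/(2 t^{3e})`
  have hfam : ∀ t : T, ∃ v : Fin (m - (∑ k, (t : ℝ) ^ dv k • Sv k).rank) → (Fin m → ℝ),
      (∀ j, (∑ k, (t : ℝ) ^ dv k • Sv k) *ᵥ v j = 0) ∧ (∀ j, v j ≠ 0) ∧
      ∀ j j', j ≠ j' → v j ⬝ᵥ ((B - (1 / (4 * (((t : ℝ) ^ e) ^ 5))) • A) *ᵥ v j') = 0 := by
    intro t
    refine exists_kernel_orthogonal_family _ _ ?_
    unfold Matrix.IsSymm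
    rw [Matrix.transpose_sub, Matrix.transpose_smul, hAs, hBs]
  choose v hv0 hvne hvorth using hfam
  -- the index type: pairs (root, basis index)
  let Idx := Σ t : T, Fin (m - (∑ k, (t : ℝ) ^ dv k • Sv k).rank)
  have hcard : Fintype.card Idx = ∑ t ∈ T, (Fintype.card (Fin m) - (∑ k, t ^ dv k • Sv k).rank) := by
    rw [Fintype.card_sigma]
    simp only [Fintype.card_fin]
    exact (Finset.sum_coe_sort T (fun t => m - (∑ k, t ^ dv k • Sv k).rank))
  have hbound : Fintype.card Idx ≤ B.rank := by
    refine card_posType_family_le_rank_gap_four (I := Idx) A J B (fun p => ((p.1 : ℝ)) ^ e) (fun p => v p.1 p.2)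
      hA.posSemidef hJ hB.posSemidef (fun p => pow_pos (hTpos p.1 p.1.2) e) (fun p => reduced_kernel_gap_four A J B d₀ e (hTpos p.1 p.1.2) _ (hv0 p.1 p.2))
      ?_ ?_
    · intro p
      have ht := hTpos p.1 p.1.2
      have hpos := hTtype p.1 p.1.2 (v p.1 p.2) (hv0 p.1 p.2) (hvne p.1 p.2)
      have heq := rayleigh_deriv_eq_gap_four A J B d₀ e ht _ (hv0 p.1 p.2)
      have h1 : 0 < (p.1 : ℝ) * (derivative (∑ k : Fin 3, C (v p.1 p.2 ⬝ᵥ ((![A, J, B] k) *ᵥ v p.1 p.2)) *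
          (X : ℝ[X]) ^ (![d₀, d₀ + e, d₀ + 5 * e] k))).eval (p.1 : ℝ) := mul_pos ht hpos
      rw [heq] at h1
      have h2 : 0 < (e : ℝ) * (p.1 : ℝ) ^ d₀ := mul_pos (Nat.cast_pos.mpr he) (pow_pos ht _)
      by_contra hcon
      push Not at hcon
      have h3 : 4 * (((p.1 : ℝ)) ^ e) ^ 5 * (v p.1 p.2 ⬝ᵥ (B *ᵥ v p.1 p.2)) - v p.1 p.2 ⬝ᵥ (A *ᵥ v p.1 p.2) ≤ 0 := by linarith
      have := mul_nonpos_of_nonneg_of_nonpos h2.le h3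
      linarith
    · rintro ⟨t, j⟩ ⟨t', j'⟩ hne htt'
      simp only at htt'
      have htt : t = t' := Subtype.ext
        ((pow_left_inj₀ (hTpos t.1 t.2).le (hTpos t'.1 t'.2).le (Nat.pos_iff_ne_zero.mp he)).mp htt')
      subst htt
      have hjj : j ≠ j' := fun h => hne (by subst h; rfl)
      have h := hvorth t j j' hjj
      have ht := hTpos t.1 t.2
      have hc : (4 * (((t : ℝ)) ^ e) ^ 5) ≠ 0 := by positivity
      rw [Matrix.sub_mulVec, Matrix.smul_mulVec, dotProduct_sub, dotProduct_smul, smul_eq_mul, sub_eq_zero] at h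
      rw [h]
      field_simp
  -- assemble
  have hBm : B.rank ≤ m := (Matrix.rank_le_width B).trans le_rfl
  rw [← hsum]
  have hNle : Multiset.card (P.roots.filter q) ≤ m := by
    rw [← hN, ← hcard]
    exact hbound.trans hBm
  have hidx' : Multiset.card (P.roots.filter fun t => 0 < t ∧ negType t) = Multiset.card (P.roots.filter q) := hidx.symm
  rw [hidx']
  omega


end GapFourDefinite

end TwoSidedThree

end Summit.ValiantsHypothesis.ValiantsHypothesis.Theorems.KPlusLogSqLaw.TowerGraft
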